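import HarnessLib
import Summits.QuantumFields.YangMills.Theses.BalabanUVNodes
import Summits.QuantumFields.YangMills.Theses.InfiniteVolumeContinuum

/-!
# Line `track-a-transport` — crux stmt-QuantumFields-19928 `InfiniteVolumeContinuum.UVCond` (HOLD alias of the spine's `BalabanLadder.UV`,
stmt-QuantumFields-19351) — by-name transport skeleton (line-writer seat ym-o4cluster g0, 2026-08-31)

HONEST FRAMING (director-ym R645-ym, verbatim obligation). Route InfiniteVolumeContinuum concludes `YangMills` only through OPEN summit-strength
existence legs (`WeakCouplingHypercubicLimit`-type: its `IVLimit` / OS legs); this registered skeleton is BOOKKEEPING for one alias leaf — a typed plan,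
not progress on the Clay problem; the Yang–Mills mass gap is NOT proved. `UVCond` is the finite-𝕋⁴, fixed-ε ultraviolet-stability rung R4 (Bałaban's
programme, [III] (B) + endpoint + spine) — NOT ℝ⁴, NOT OS, NOT a gap, NOT Clay; nothing of Bałaban is discharged by registering this file.

WHAT THIS ITEM IS. `InfiniteVolumeContinuum.UVCond` is VERBATIM the spine item `BalabanLadder.UV` (stmt-QuantumFields-19351): `uvCond_iff_spineUV` below is
`Iff.rfl`. The spine's `UV` is never staffed head-on (director R85 hold): it is discharged through the DETAIL ROUTE Track A = route-QuantumFields-BalabanUVNodes,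
whose deciding theorem TODAY (rev ≥ 32) is
`BalabanUVNodes.closes (h0 : Record13SepCoPHInhabitedAx) (h1 : StabilityBRunRowsAtRecordR13SepCoPHVAx) (h2 : EndpointGivenRunRowsR13SepCoPHVAx)
(h3 : SpineGivenEndpointR13SepCoPHVAx) : BalabanLadder.UV`.
So the honest typed plan for this alias is: the four LIVE Track-A items BY NAME ⇒ `UV` (Track A's `closes`, by name) ⇒ `UVCond` (definitional alias).
The four stubs below are those items; they close BY NAME the day Track A's items close — no work is forked to this item, DO NOT STAFF HERE
(staff Track A). CUSTODY NOTE: Track A re-keys its `closes` binders often (birth revs 6/8/10/11/12 of `Cruxes/UV/Lines/birth.lean` each went stale at a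
re-key); when that happens this transport goes stale too and is re-copied with the new four names — the alias constant `UVCond` never changes.

`UVCond_of : InfiniteVolumeContinuum.UVCond` is the ONLY theorem here concluding the crux decl (audit-unambiguous); `sorry` occurs EXACTLY in the four
`stub_*`. [Balaban1989LargeFieldII; Balaban1988CMP116]
-/

namespace Summit.QuantumFields.YangMills.Cruxes.UVCond.TrackATransport

open Summit.QuantumFields.YangMills.Theses

/-- The alias is definitional: `InfiniteVolumeContinuum.UVCond ↔ BalabanLadder.UV` by `Iff.rfl`. [folklore] -/
theorem uvCond_iff_spineUV : InfiniteVolumeContinuum.UVCond ↔ BalabanLadder.UV :=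
  Iff.rfl

/-! ## Registered stubs `stub_<name>` (`sorry` lives ONLY here) = Track A's four live items BY NAME -/

/-- stub K0 = Track A item `Record13SepCoPHInhabitedAx` by name: on every four-torus family the Stage-13 record of record (SepCoPH, Ax reading)
is inhabited. Size L (port bookkeeping over the Literature record files). [Balaban1989LargeFieldII] -/
theorem stub_K0 : BalabanUVNodes.Record13SepCoPHInhabitedAx := by
  sorry

/-- stub K1 = Track A item `StabilityBRunRowsAtRecordR13SepCoPHVAx` by name: [III]'s (B) with run rows inside the small-coupling window at the
record of record. Size XL (the renormalisation-group induction of Bałaban 1983–89). [Balaban1989LargeFieldII] -/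
theorem stub_K1 : BalabanUVNodes.StabilityBRunRowsAtRecordR13SepCoPHVAx := by
  sorry

/-- stub K2 = Track A item `EndpointGivenRunRowsR13SepCoPHVAx` by name (Track A marks it glue-sized: endpoint existence given the run rows).
Size M. [Balaban1988CMP116] -/
theorem stub_K2 : BalabanUVNodes.EndpointGivenRunRowsR13SepCoPHVAx := by
  sorry

/-- stub K3 = Track A item `SpineGivenEndpointR13SepCoPHVAx` by name: the hybrid spine given (B) + endpoint. Size L. [Balaban1988CMP116] -/
theorem stub_K3 : BalabanUVNodes.SpineGivenEndpointR13SepCoPHVAx := by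
  sorry

/-! ## Composition (kernel-checked; no `sorry` below this line) -/

/-- The spine statement from the four stubs through Track A's deciding theorem BY NAME (conclusion `BalabanLadder.UV`, not this item's decl). [folklore] -/
theorem spineUV_of_stubs : BalabanLadder.UV :=
  BalabanUVNodes.closes stub_K0 stub_K1 stub_K2 stub_K3

/-- **Composition `UVCond_of`**: the alias crux BY NAME — the ONLY theorem in this file whose conclusion is `InfiniteVolumeContinuum.UVCond`. [folklore] -/
theorem UVCond_of : InfiniteVolumeContinuum.UVCond :=
  uvCond_iff_spineUV.2 spineUV_of_stubs

end Summit.QuantumFields.YangMills.Cruxes.UVCond.TrackATransport
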